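import Mathlib
import HarnessLib
import Summits.ValiantsHypothesis.ValiantsHypothesis.Theses.MonotoneRestoration
import Literature.Computability.AlgebraicComplexity.ArithCircuit
import Literature.Computability.AlgebraicComplexity.ArithCircuitProofs
import Literature.Computability.AlgebraicComplexity.MonotoneStructure
import Literature.Computability.AlgebraicComplexity.PermanentIrreducible
import Literature.ModelTheory.FiniteModelTheory.CkEquiv
import Summits.ValiantsHypothesis.ValiantsHypothesis.Theorems.MonotoneRestorationMonotoneRestorationQPCosetCount
import Summits.ValiantsHypothesis.ValiantsHypothesis.Theorems.MonotoneRestorationMonotoneRestorationQPSymmetricLB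
import Summits.ValiantsHypothesis.ValiantsHypothesis.Theorems.MonotoneRestorationMonotoneRestorationQPSupportSymmetrisation
import Summits.ValiantsHypothesis.ValiantsHypothesis.Theorems.MonotoneRestorationMonotoneRestorationQPSparseRegime
import Summits.ValiantsHypothesis.ValiantsHypothesis.Theorems.MonotoneRestorationMonotoneRestorationQPBeta
import Literature.Computability.AlgebraicComplexity.SymmetricArithCircuit
import Literature.Computability.AlgebraicComplexity.DawarWilsenach2025Proofs
import Literature.GroupTheory.PermutationGroups.SmallIndexSubgroups
import Summits.ValiantsHypothesis.ValiantsHypothesis.Theorems.MonotoneRestorationQP.Negative.LoadBearing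
import Summits.ValiantsHypothesis.ValiantsHypothesis.Theorems.MonotoneRestorationMonotoneRestorationQPPermSupportCount

/-! TTRL-lite variant V20174 of stmt-ValiantsHypothesis-15886 -/

-- `Summit.ValiantsHypothesis.ValiantsHypothesis.…` is the tree's mandated single-conjunct layout
-- (Sub = Summit), so the duplicated namespace component is intended.
set_option linter.dupNamespace false

namespace Summit.ValiantsHypothesis.ValiantsHypothesis.Theorems

open Summit.ValiantsHypothesis.ValiantsHypothesis.Theses.MonotoneRestoration
open Literature.Computability.AlgebraicComplexity

/-- **TTRL-lite variant V20174** of `stub_esymmRowSums_structure` (the `τ`-half of the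
bi-permutation invariance conjunct, in isolation): permuting the columns of the `n × n` variable
matrix by `τ` only reindexes the `i`-th row sum, `Σ_j x_{i,τ j} = Σ_j x_{i,j}`. Proof: this is
`Equiv.sum_comp τ (fun j => X (i, j))`, i.e. a bijective reindexing of a finite sum. [folklore] -/
theorem stub_esymmRowSums_structure_var20174 :
    ∀ (n : ℕ) (τ : Equiv.Perm (Fin n)) (i : Fin n),
      ∑ j : Fin n, (MvPolynomial.X (i, τ j) : MvPolynomial (Fin n × Fin n) NNReal) =
        ∑ j : Fin n, MvPolynomial.X (i, j) := by
  intro n τ i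
  exact Equiv.sum_comp τ (fun j => (MvPolynomial.X (i, j) : MvPolynomial (Fin n × Fin n) NNReal))

end Summit.ValiantsHypothesis.ValiantsHypothesis.Theorems
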